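import Literature.Algebra.Homology.DiscreteRepInflation
import HarnessLib

/-!
# Inflation of DISCRETE representations along a quotient `Γ ↠ Γ ⧸ N` by an arbitrary (e.g. closed, non-open)
# normal subgroup: `C_{Γ/N} ⥤ C_Γ` (Harari, *Galois Cohomology and CFT*, §4.2–§4.3; used for `G_S = Γ_K ⧸ N_S`)

Topic `Algebra/Homology`; namespace `Literature.Algebra.Homology.DiscreteRep`; sequel to `DiscreteRepInflation.lean`, whose
`infFunctor k U hU : Rep k (Γ ⧸ U) ⥤ C_Γ` needs `U` OPEN (it inflates ARBITRARY representations of `Γ ⧸ U`).  For a normal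
subgroup `N` that is not open (the ramification subgroup `N_S ≤ Γ_K`, with `Γ_K ⧸ N_S = G_S = Gal(K_S/K)`) one can still
inflate the DISCRETE representations of `Γ ⧸ N`: the stabiliser of a vector in the inflation is the preimage of its (open)
stabiliser under the continuous projection.  Definitions with bodies and theorems; NO named fact, no `sorry`, no notation.

## What is formalised (`k Γ : Type u`, `Γ` a topological group, `N` a normal subgroup, quotient topology on `Γ ⧸ N`)

* `coe_stabilizer_res_mk'` (the stabiliser in the inflation is the preimage of the stabiliser),
  **`isDiscrete_res_mk'_of_isDiscrete`** (inflation of a discrete `Γ ⧸ N`-module is discrete),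
  **`inflQuotFunctor k N : DiscreteRepCat k (Γ ⧸ N) ⥤ DiscreteRepCat k Γ`**, `inflQuotFunctorCompιIso` (it is
  `Rep.resFunctor (QuotientGroup.mk' N)` on underlying representations, definitionally), `inflQuotFunctor_map_hom`
  (`rfl`), **`inflQuotFunctor_faithful`**.

Written for lane «PT-Ш-S-TC» (bricks D3/D4b: read a `G_S`-morphism `X ⟶ I_S` through door-c6's `Γ_K`-readout) of crux
`GoodLatticeBDPValue` (cell bsd-eis, item 19032), seat bsd-line-x1-p1-w6 gen 10.  HONEST FRAMING: category bookkeeping only.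

## References
* D. Harari, *Galois Cohomology and Class Field Theory*, Universitext, Springer (2020), §4.2 Definition 4.14, §4.3
  Remark 4.24. [Harari2020]
-/

noncomputable section

universe u

namespace Literature.Algebra.Homology

namespace DiscreteRep

open CategoryTheory

variable {k Γ : Type u} [CommRing k] [Group Γ] (N : Subgroup Γ) [N.Normal]

/-- **The stabiliser of a vector of an inflated representation is the preimage of its stabiliser in `Γ ⧸ N`.**
[cite: Harari2020, §4.2 Definition 4.14] -/
theorem coe_stabilizer_res_mk' (B : Rep.{u} k (Γ ⧸ N)) (b : B.V) :
    (stabilizer (Rep.res (QuotientGroup.mk' N) B) b : Set Γ) =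
      (QuotientGroup.mk : Γ → Γ ⧸ N) ⁻¹' (stabilizer B b : Set (Γ ⧸ N)) := by
  ext g
  simp only [SetLike.mem_coe, Set.mem_preimage, mem_stabilizer_iff]
  exact Iff.rfl

variable [TopologicalSpace Γ]

/-- **The inflation of a DISCRETE `Γ ⧸ N`-representation is a discrete `Γ`-representation** (for any normal `N`, the
quotient carrying the quotient topology). [cite: Harari2020, §4.2 Definition 4.14] -/
theorem isDiscrete_res_mk'_of_isDiscrete (B : Rep.{u} k (Γ ⧸ N)) (hB : IsDiscrete B) :
    IsDiscrete (Rep.res (QuotientGroup.mk' N) B) := fun b => by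
  rw [coe_stabilizer_res_mk']
  exact (hB b).preimage QuotientGroup.continuous_mk

variable (k) in
/-- **Inflation of discrete representations `C_{Γ/N} ⥤ C_Γ`** along `Γ ↠ Γ ⧸ N`, for an arbitrary normal subgroup `N`.
[cite: Harari2020, §4.3 Remark 4.24] -/
def inflQuotFunctor : DiscreteRepCat k (Γ ⧸ N) ⥤ DiscreteRepCat k Γ :=
  (isDiscrete k Γ).lift (ι k (Γ ⧸ N) ⋙ Rep.resFunctor (QuotientGroup.mk' N))
    fun B => isDiscrete_res_mk'_of_isDiscrete N B.obj B.property

/-- `inflQuotFunctor ⋙ ι = ι ⋙ Rep.resFunctor (Γ → Γ/N)` (definitionally). [cite: Harari2020, §4.3 Remark 4.24] -/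
def inflQuotFunctorCompιIso :
    inflQuotFunctor k N ⋙ ι k Γ ≅ ι k (Γ ⧸ N) ⋙ Rep.resFunctor (QuotientGroup.mk' N) := Iso.refl _

/-- On objects: the underlying representation of `inflQuotFunctor B` is `Rep.res (Γ → Γ/N) B` (definitional).
[cite: Harari2020, §4.3 Remark 4.24] -/
theorem inflQuotFunctor_obj_obj (B : DiscreteRepCat k (Γ ⧸ N)) :
    ((inflQuotFunctor k N).obj B).obj = Rep.res (QuotientGroup.mk' N) B.obj := rfl

/-- On morphisms: `inflQuotFunctor` is the identity on underlying linear maps (definitional).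
[cite: Harari2020, §4.3 Remark 4.24] -/
theorem inflQuotFunctor_map_hom_hom {B B' : DiscreteRepCat k (Γ ⧸ N)} (f : B ⟶ B') (b : B.obj.V) :
    ((inflQuotFunctor k N).map f).hom.hom b = f.hom.hom b := rfl

/-- **`inflQuotFunctor` is faithful.** [cite: Harari2020, §4.3 Remark 4.24] -/
theorem inflQuotFunctor_faithful : (inflQuotFunctor k N).Faithful :=
  ⟨fun {B B'} {f g} h =>
    ObjectProperty.hom_ext _ (Rep.hom_ext (DFunLike.ext _ _ fun b => by
      have hb := congrArg (fun e => e.hom.hom b) h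
      exact hb))⟩

end DiscreteRep

end Literature.Algebra.Homology

end
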